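import Literature.MathematicalPhysics.QuantumFieldTheory.Balaban1983to89.B2Eq2108ErrorHiggsLattice
import Literature.MathematicalPhysics.QuantumFieldTheory.Balaban1983to89.B2Eq243RegionsTower
import Literature.MathematicalPhysics.QuantumFieldTheory.Balaban1983to89.B2Eq28RegionsCollars

/-!
# `Balaban1983to89.B2Ineq2109HiggsLatticeTower` — [Balaban1982Higgs2] **(2.108)–(2.109)** p. 580 on the (Higgs)₂,₃ carrier of
# record FOR THE CONSTRUCTED TOWER OF SMALL-FIELD REGIONS: the six sets `Λ₂^{(k−1)′} ⊇ Λ₆^{(k−1)′} ⊇ Λ₃^{(k)} ⊇ Λ₄^{(k)} ⊇ Λ₅^{(k)}`,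
# `Λ₂^{(k)}` of (2.108) ARE the typer's `B2Eq243RegionsTower.towerRegion` built by (2.7)–(2.8)/(2.43) from the large-field points of
# every step, and the nesting and the (2.8) separations that `B2Ineq2109HiggsLattice.Adm` took as hypotheses are DISCHARGED for them;
# hence `B2Sect2Statements.Ineq2109` / `B2Sect3AStatements.Ineq38`, the second inequality of (2.109) with the printed `r(Lᵏε)`, and
# the `O((Lᵏε)^κ)|Λ₃^{(k)}|` error term of (2.108) hold for the family indexed by (torus, `N`, charge, mass, level, large-field data,
# regular `B̃`) — the only standing hypothesis left is the regularity of the field `B̃` on `Ω = Bᵏ(Λ₂^{(k−1)′})` (print's (2.94)–(2.98))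

statement-level skeleton of published theorems with citation tags; proofs where landed; nothing here is a claim about the Yang–Mills mass gap

PDF held: `paper:balaban1982-cmp86-higgs23-ii` (T. Bałaban, *(Higgs)₂,₃ quantum fields in a finite volume. II. An upper
bound*, Commun. Math. Phys. **86** (1982) 555–594, doi 10.1007/bf01214890 [Balaban1982Higgs2]; journal page = PDF page + 554);
pp. 558, 566, 570, 580 [PDF 4, 12, 16, 26] READ AS IMAGES on the ×2 renders
`run/shared/lean/pub/pub-balaban/b2b-balaban-ref1/pages/1982-cmp86-higgs23-II/1982-cmp86-higgs23-II-p0NN-x2.png`; v1.1 (this seat's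
gen 17): the (2.7)–(2.8) quotation below replaced by the printed sentences of p. 558 (render p004-x2 re-read; referee note
S-B2-g45-1) — docstring-only change, every declaration byte-identical.

CITATION HEADER (lean-in-tree rule).  Cell `lit-balaban` (HOME `run/shared/lean/pub/lit-balaban/`), Phase-2 proof seat **p23**
gen 15 (unit `lit-balaban-p23-g15`; TAKING line HOME/STATUS.md 2026-08-22T09:45:10Z).  SKELETON row **B2.Eq2.109** ((2.108)–(2.109)
p. 580; decl of record `…B2Sect2Statements.Ineq2109`, r02, UNCHANGED; head `proved p260028`), cells only; xref rows B2.Eq2.7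
((2.7)–(2.8)), B2.Eq2.43 (the tower), B2.Eq3.1-3.10 ((3.8)).  Fold owner r02, second reader r14, referee ref-4.  USED BY NAME, files
untouched: this seat's gen-15 `B2Ineq2109HiggsLattice.{Inst, Adm, AdmIdx, ineq2109_higgsLattice, ineq2109_pow_higgsLattice, norm_Hk_le}`
(p325417) and `B2Eq2108ErrorHiggsLattice.{abs_form_hk_le, abs_form_hk_le_printed, KW}` (p325997); the typer's `B2Eq243RegionsTower.
{towerRegion, towerRegion_antitone, towerRegion_succ_subset_prime, sep_towerRegion}` (the tower of regions of all the steps and its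
(2.8) separations, typer g9) and p15's `B2Eq324NestedRegions.{prime, mem_prime}` (`Λ′`), gen-13 `B2Eq28RegionsCollars.prime_mono`;
`B1Ineq234LevelZero.tdist_comm`; r02 `B2Sect2Statements.Ineq2109`, `B2Sect3AStatements.Ineq38`; `B2.rFn` ((2.7)).

WHAT IS PRINTED (the printed sentences, renders read as images).  p. 558 [PDF 4], (2.7)–(2.8): *"Λ₀^c is the sum of all
large blocks of T₁ distant from one of the sets B(P_v), Q_v, R_v, B(P_s), Q_s, R_s less than r(ε) = R(1 + log ε⁻¹)^r. The numbers
r, R satisfy r > 1, R > R₀ (R₀ occurs in the formulation of Proposition I.2.1). (2.7) Next let us define a sequence of sets Λ₁,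
Λ₂, … by an induction Λ_{i+1}^c is the sum of all large blocks of T₁ with distances from the set Λ_i^c less or equal r(ε). (2.8)"*;
p. 566 [PDF 12]: *"In general Λ₀^{(j+1)} ⊂ Λ₇^{(j)′}"*; p. 580 [PDF 26], (2.108)–(2.109):
*"More exactly the difference between the quadratic forms is a quadratic form
½⟨Λ₆^{(k−1)′}φ, H_kΛ₆^{(k−1)′}φ⟩ and for the matrix elements h_k(x, x′) of the operator H_k of this form, the following inequality
holds |h_k(x, x′)| ≦ O(1)exp(−δ₁r(Lᵏε))exp(−δ₀|x − x′|) ≦ O((Lᵏε)^κ)exp(−δ₀|x − x′|)  (2.109)  for x, x′ ∈ Λ₆^{(k−1)′} and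
arbitrary κ."*  (full (2.108) quotation and the argument: header of `B2Ineq2109HiggsLattice`.)

WHAT THIS FILE ADDS.  In `B2Ineq2109HiggsLattice` the sets of (2.108) were abstract finite sets of `k`-sites with the nesting
`Inst.h6 … h2k` and the (2.8) separations `Adm.sep45/sep34/sep2k` as hypotheses (HONEST SCOPE (b) there).  Here they are THE
CONSTRUCTED SETS: for large-field data `bad : (l : ℕ) → Set (Site P l)` and radii `rad l` ↤ `r(Lˡε)` (the typer's tower
`towerRegion bad rad l i = Λ_i^{(l)}`), at the step `k = j + 1`:
  `Λ₂^{(k−1)′} = prime (towerRegion bad rad j 2)`, `Λ₆^{(k−1)′} = prime (towerRegion bad rad j 6)` (p15's `prime` = `Λ ∩ T^{(k)}`),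
  `Λ_i^{(k)} = towerRegion bad rad (j+1) i` (`i = 2, 3, 4, 5`),
and the six inclusions and three separations are PROVED from the typer's `towerRegion_antitone` ((2.8) nesting),
`towerRegion_succ_subset_prime` (p. 566 *"Λ₀^{(j+1)} ⊂ Λ₇^{(j)′}"*) and `sep_towerRegion` ((2.8): `x ∈ Λ_{i′}`, `y ∉ Λ_i`, `i < i′`
⇒ `|x − y| > r`).  The field `B̃` and its regularity on `Ω` stay data/hypothesis exactly as in r14's regular-region theorems.

DICTIONARY (print ↦ Lean).  `TowerData P N` = one step on one torus: level `j` (`k = j+1 ≤ K`), charge data `C`, field `A` ↤ `B̃`,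
mass `msq`, regularity modulus `dA`, large-field data `bad`, radii `rad` (with `rad j, rad (j+1) ≥ 0`); `TowerData.toInst` = the
`B2Ineq2109HiggsLattice.Inst` with the constructed sets; `TowerData.Reg a` = r14's lattice form of (I.2.23) on `Ω` + the coupling
smallness; `TowerIdx d L a` = the index type of the family (fixed `d`, `L`, `a`); `printedRad Q P l = r(Lˡε) = B2.rFn Q.R Q.r (P.mesh l)`.

WHAT IS KERNEL-CHECKED (zero `sorry`, no `def … : Prop` fact; axioms standard).
 §1 `TowerData`, `toInst` (the six inclusions PROVED), projection lemmas; §2 **`adm_toInst`**: `Adm a t.toInst` from the regularity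
    of the field ALONE — `sep45/sep34/sep2k` and `0 ≤ r` DISCHARGED by the tower; §3 `TowerIdx`, `toAdmIdx`, **`ineq2109_tower :
    B2Sect2Statements.Ineq2109 …`** and **`ineq38_tower : B2Sect3AStatements.Ineq38 …`** for the tower family, `abs_hk_le_tower`
    (pointwise, explicit), **`ineq2109_pow_tower`** ((2.109)₂ with the PRINTED radii `r(Lᵏε)`, every `κ`), `norm_Hk_le_tower` ((3.12));
 §4 the (2.108) error term for the tower: **`abs_form_hk_le_tower`** (`|⟨φ,H_kφ⟩| ≤ C·N²·K_W·(Lᵏε)⁻⁴·t²·e^{−δr/2}·|Λ₃^{(k)}|` with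
    `|Λ₃^{(k)}| = (towerRegion bad rad k 3).card`) and **`abs_form_hk_le_printed_tower`** (`O((Lᵏε)^κ)|Λ₃^{(k)}|` under the (2.7)
    field bound, printed radii); §5 `printedRad_nonneg`, **`TowerData.printed`** (the instance with `rad = r(L^·ε)`), and NON-VACUITY
    with a field `≠ 0`: `TowerData.const` / `constIdx` (every torus with `K ≥ 1`, every large-field datum, every constant `B̃ ≡ v`,
    `v ≠ 0` allowed: regularity modulus `0`), `constIdx_A_ne_zero`.

HONEST SCOPE.  (a) What is discharged: the set-theoretic standing context of (2.108) (nesting, (2.8) separations, `r ≥ 0`) for the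
tower of record; what remains a hypothesis: the (I.2.23)-regularity of `B̃` on `Ω = Bᵏ(Λ₂^{(k−1)′})` with r14's coupling smallness
(print: (2.94)–(2.98) p. 576 and *"this configuration satisfies the regularity assumption of Proposition I.2.1"* p. 579 — a
derivation from Lemma 2.3's bounds, not re-done here; cf. gen-10 `B2Eq32FieldRegularity` for the §3 field).  (b) The tower is the
typer's `towerRegion` for ARBITRARY large-field data `bad` and radii `rad` (the printed radii are the instance `TowerData.printed`);
admissibility/minimality of the large-field sets ((2.9)) plays no role in (2.109) and is not assumed.  (c) `B̃` on `Ω₂ = Bᵏ(Λ₂^{(k)})`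
is the same field (domain reading of the fourth term, as in `B2Ineq2109HiggsLattice` (a)).  (d) Constants: those of
`B2Ineq2109HiggsLattice`/`B2Eq2108ErrorHiggsLattice` (r14's, explicit, crude).  (e) Cells only; no head change; NOT summit progress.
-/

noncomputable section

open scoped BigOperators Matrix

namespace Literature.MathematicalPhysics.QuantumFieldTheory.Balaban1983to89.B2Ineq2109HiggsLatticeTower

open HiggsLattice HiggsAveraging HiggsCovariance B1Eq230FluctCov
open B1Ineq234LevelZero (tdist_comm)
open B2Ineq2109HiggsLattice B2Eq2108ErrorHiggsLattice
open B2Eq324NestedRegions (prime mem_prime)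
open B2Eq28RegionsCollars (prime_mono)
open B2Eq243RegionsTower (towerRegion towerRegion_antitone towerRegion_succ_subset_prime sep_towerRegion)
open Matrix

variable {P : HiggsLattice.Params} {N : ℕ}


/-! ## §1 One step of (2.108) with the CONSTRUCTED sets -/

/-- The data of one step `k = j + 1` of (2.108) on a `HiggsLattice` torus with the regions taken from the tower of record: charge
data, the field `B̃`, the mass, the regularity modulus `δ_A`, the large-field points `bad l ⊂ T^{(l)}` of every step and the radii
`rad l` ↤ `r(Lˡε)` of (2.7)–(2.8) (nonnegative at the two levels used). [cite: Balaban1982Higgs2, (2.108) p.580, (2.7)–(2.8) p.558, (2.43) p.566] -/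
structure TowerData (P : HiggsLattice.Params) (N : ℕ) where
  j : ℕ
  hjK : j + 1 ≤ P.K
  C : ChargeData N
  A : HiggsLattice.VecField P 0
  msq : ℝ
  hmsq : 0 < msq
  dA : ℝ
  bad : (l : ℕ) → Set (HiggsLattice.Site P l)
  rad : ℕ → ℝ
  hrad0 : 0 ≤ rad j
  hrad1 : 0 ≤ rad (j + 1)

namespace TowerData

variable (t : TowerData P N)

/-- `Λ_i^{(k−1)} ⊂ T^{(k−1)}`: the regions of the previous step (typer's tower at level `j`). [cite: Balaban1982Higgs2, (2.43) p.566] -/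
abbrev lamPrev (i : ℕ) : Finset (HiggsLattice.Site P t.j) := towerRegion t.bad t.rad t.j i

/-- `Λ_i^{(k)} ⊂ T^{(k)}`: the regions of the current step (typer's tower at level `j + 1`). [cite: Balaban1982Higgs2, (2.43) p.566] -/
abbrev lam (i : ℕ) : Finset (HiggsLattice.Site P (t.j + 1)) := towerRegion t.bad t.rad (t.j + 1) i

/-- **The instance of (2.108) with the constructed sets**: `Λ₂^{(k−1)′} = (Λ₂^{(k−1)})′`, `Λ₆^{(k−1)′} = (Λ₆^{(k−1)})′`, `Λ₃^{(k)}, Λ₄^{(k)},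
Λ₅^{(k)}, Λ₂^{(k)}` from the tower, `r = r(Lᵏε)`; the six inclusions of `Inst` PROVED: within a step by the (2.8) nesting
(`towerRegion_antitone`), across the step by p. 566 *"Λ₀^{(j+1)} ⊂ Λ₇^{(j)′}"* (`towerRegion_succ_subset_prime`) and `Λ ⊆ Λ̃ ⇒ Λ′ ⊆ Λ̃′`.
[cite: Balaban1982Higgs2, (2.108) p.580, (2.8) p.558, (2.43) p.566] -/
def toInst : Inst P N where
  j := t.j
  hjK := t.hjK
  C := t.C
  A := t.A
  msq := t.msq
  hmsq := t.hmsq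
  dA := t.dA
  L2p := prime (t.lamPrev 2)
  L6 := prime (t.lamPrev 6)
  L3 := t.lam 3
  L4 := t.lam 4
  L5 := t.lam 5
  L2k := t.lam 2
  h6 := prime_mono (towerRegion_antitone t.hrad0 (by norm_num))
  h36 := (towerRegion_succ_subset_prime t.hrad1 3).trans (prime_mono (towerRegion_antitone t.hrad0 (by norm_num)))
  h43 := towerRegion_antitone t.hrad1 (by norm_num)
  h54 := towerRegion_antitone t.hrad1 (by norm_num)
  h32 := towerRegion_antitone t.hrad1 (by norm_num)
  h2k := (towerRegion_succ_subset_prime t.hrad1 2).trans (prime_mono (towerRegion_antitone t.hrad0 (by norm_num)))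
  r := t.rad (t.j + 1)

/-- the level of the instance. [cite: Balaban1982Higgs2, (2.108) p.580] -/
@[simp] theorem toInst_j : t.toInst.j = t.j := rfl
/-- the charge data of the instance. [cite: Balaban1982Higgs2, (2.108) p.580] -/
@[simp] theorem toInst_C : t.toInst.C = t.C := rfl
/-- the field `B̃` of the instance. [cite: Balaban1982Higgs2, (2.108) p.580] -/
@[simp] theorem toInst_A : t.toInst.A = t.A := rfl
/-- the mass of the instance. [cite: Balaban1982Higgs2, (2.108) p.580] -/
@[simp] theorem toInst_msq : t.toInst.msq = t.msq := rfl
/-- the regularity modulus of the instance. [cite: Balaban1982Higgs2, (2.108) p.580] -/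
@[simp] theorem toInst_dA : t.toInst.dA = t.dA := rfl
/-- the radius of the instance is `r(Lᵏε)`, `k = j + 1`. [cite: Balaban1982Higgs2, (2.8) p.558] -/
@[simp] theorem toInst_r : t.toInst.r = t.rad (t.j + 1) := rfl

/-- `Λ₂^{(k−1)′}` of the instance is `(Λ₂^{(k−1)})′` of the tower. [cite: Balaban1982Higgs2, (2.108) p.580] -/
theorem toInst_L2p : t.toInst.L2p = prime (t.lamPrev 2) := rfl
/-- `Λ₆^{(k−1)′}` of the instance is `(Λ₆^{(k−1)})′` of the tower. [cite: Balaban1982Higgs2, (2.108) p.580] -/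
theorem toInst_L6 : t.toInst.L6 = prime (t.lamPrev 6) := rfl
/-- `Λ₃^{(k)}` of the instance is the tower's. [cite: Balaban1982Higgs2, (2.108) p.580] -/
theorem toInst_L3 : t.toInst.L3 = t.lam 3 := rfl
/-- `Λ₄^{(k)}` of the instance is the tower's. [cite: Balaban1982Higgs2, (2.108) p.580] -/
theorem toInst_L4 : t.toInst.L4 = t.lam 4 := rfl
/-- `Λ₅^{(k)}` of the instance is the tower's. [cite: Balaban1982Higgs2, (2.108) p.580] -/
theorem toInst_L5 : t.toInst.L5 = t.lam 5 := rfl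
/-- `Λ₂^{(k)}` of the instance is the tower's. [cite: Balaban1982Higgs2, (2.108) p.580] -/
theorem toInst_L2k : t.toInst.L2k = t.lam 2 := rfl

/-- `Ω = Bᵏ(Λ₂^{(k−1)′})` of the instance: the fine sites whose `k`-block label lies in `(Λ₂^{(k−1)})′`. [cite: Balaban1982Higgs2, (2.87) p.575] -/
theorem mem_Ω (x : HiggsLattice.Site P 0) : x ∈ t.toInst.Ω ↔ HiggsAveraging.blockIter (t.j + 1) x ∈ prime (t.lamPrev 2) :=
  t.toInst.mem_reg _ x

/-! ## §2 The standing context: only the regularity of the field is left -/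

/-- The hypothesis on the field that remains: r14's lattice form of (I.2.23) for `B̃` on `Ω = Bᵏ(Λ₂^{(k−1)′})`,
`|B̃_μ(z + εe_ν) − B̃_μ(z)| ≤ δ_A`, with the coupling smallness `d²·ε|e|·L^{2k}·δ_A ≤ 1/3` (*"for e(Lᵏε) sufficiently small"*; print
derives the regularity of the (2.93) configuration in (2.94)–(2.98)). [cite: Balaban1982Higgs2, (2.94)–(2.98) p.576, p.579] -/
structure Reg (a : ℝ) (t : TowerData P N) : Prop where
  reg : ∀ z ∈ t.toInst.Ω, ∀ μ ν : Fin P.d, |t.A ⟨z.shift ν, μ⟩ - t.A ⟨z, μ⟩| ≤ t.dA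
  small : (P.d : ℝ) ^ 2 * (P.mesh 0 * |t.C.e|) * ((P.L : ℝ) ^ (t.j + 1)) ^ 2 * t.dA ≤ 1 / 3

/-- **The (2.8) separations and `r ≥ 0` DISCHARGED**: for the constructed sets, `Adm a` holds as soon as the field is regular on `Ω`
— `sep45` (`y ∉ Λ₄^{(k)}`, `u ∈ Λ₅^{(k)}` ⇒ `|y − u| ≥ r(Lᵏε)`), `sep34`, `sep2k` (`y ∈ Λ₃^{(k)}`, `u ∉ Λ₂^{(k)}`) are the typer's
`sep_towerRegion` (even with `>`). [cite: Balaban1982Higgs2, (2.8) p.558, (2.108) p.580] -/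
theorem adm_toInst {a : ℝ} (h : Reg a t) : Adm a t.toInst where
  reg := h.reg
  small := h.small
  hr := t.hrad1
  sep45 := fun y _ hy4 u hu => by
    have h1 := sep_towerRegion t.hrad1 (show 4 < 5 by norm_num) hu hy4
    rw [tdist_comm] at h1
    exact h1.le
  sep34 := fun y _ hy3 u hu => by
    have h1 := sep_towerRegion t.hrad1 (show 3 < 4 by norm_num) hu hy3
    rw [tdist_comm] at h1
    exact h1.le
  sep2k := fun y hy u _ hu2 => (sep_towerRegion t.hrad1 (show 2 < 3 by norm_num) hy hu2).le

end TowerData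

/-! ## §3 The family over the tower of record: (2.109)₁ = (3.8), (2.109)₂, (3.12) -/

/-- the index type of the tower family with fixed `(d, L, a)`: a torus of the model with these `d, L`, a number of components `N`,
one step's tower data, and a field regular on `Ω`. [cite: Balaban1982Higgs2, (2.109) p.580] -/
structure TowerIdx (d L : ℕ) (a : ℝ) where
  P : HiggsLattice.Params
  hd : P.d = d
  hL : P.L = L
  N : ℕ
  t : TowerData P N
  reg : TowerData.Reg a t

namespace TowerIdx

variable {d L : ℕ} {a : ℝ} (ι : TowerIdx d L a)

/-- a tower index is an admissible index of `B2Ineq2109HiggsLattice`. [cite: Balaban1982Higgs2, (2.109) p.580] -/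
def toAdmIdx : AdmIdx d L a := ⟨ι.P, ι.hd, ι.hL, ι.N, ι.t.toInst, ι.t.adm_toInst ι.reg⟩

/-- the instance of a tower index is the constructed one. [cite: Balaban1982Higgs2, (2.109) p.580] -/
@[simp] theorem toAdmIdx_i : ι.toAdmIdx.i = ι.t.toInst := rfl
/-- same torus. [cite: Balaban1982Higgs2, (2.109) p.580] -/
@[simp] theorem toAdmIdx_P : ι.toAdmIdx.P = ι.P := rfl
/-- same number of components. [cite: Balaban1982Higgs2, (2.109) p.580] -/
@[simp] theorem toAdmIdx_N : ι.toAdmIdx.N = ι.N := rfl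

end TowerIdx

/-- **ROW B2.Eq2.109 for the tower of record — `B2Sect2Statements.Ineq2109` INHABITED** by the family of all steps of all towers
(`X = Λ₆^{(k−1)′} × {1,…,N}` with `Λ₆^{(k−1)′} = (towerRegion bad rad (k−1) 6)′`, unit-lattice kernel `(Lᵏε)²h_k`, torus distance,
`r = rad k`): *"|h_k(x,x′)| ≤ O(1)exp(−δ₁r(Lᵏε))exp(−δ₀|x − x′|), x, x′ ∈ Λ₆^{(k−1)′}"* with ONE `(O(1), δ₀, δ₁)` per `(d, L, a)`.
[cite: Balaban1982Higgs2, (2.109) p.580] -/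
theorem ineq2109_tower (d L : ℕ) (hL : 1 < L) {a : ℝ} (ha : 0 < a) :
    B2Sect2Statements.Ineq2109 (fun ι : TowerIdx d L a => ↥ι.t.toInst.L6 × Ix ι.N)
      (fun ι p q => ι.t.toInst.hkUnit a p q)
      (fun _ p q => (HiggsLattice.Site.tdist p.1.1 q.1.1 : ℝ)) (fun ι => ι.t.rad (ι.t.j + 1)) := by
  obtain ⟨C, δ₀, δ₁, hδ₀, hδ₁, h⟩ := ineq2109_higgsLattice d L hL ha
  exact ⟨C, δ₀, δ₁, hδ₀, hδ₁, fun ι p q => h ι.toAdmIdx p q⟩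

/-- (3.8) p. 584 = (2.109)₁ for the tower family (r02's `Ineq38` is `Ineq2109`). [cite: Balaban1982Higgs2, (3.8) p.584] -/
theorem ineq38_tower (d L : ℕ) (hL : 1 < L) {a : ℝ} (ha : 0 < a) :
    B2Sect3AStatements.Ineq38 (fun ι : TowerIdx d L a => ↥ι.t.toInst.L6 × Ix ι.N)
      (fun ι p q => ι.t.toInst.hkUnit a p q)
      (fun _ p q => (HiggsLattice.Site.tdist p.1.1 q.1.1 : ℝ)) (fun ι => ι.t.rad (ι.t.j + 1)) :=
  ineq2109_tower d L hL ha

/-- (2.109)₁ POINTWISE for a tower step, explicit: `|h_k(x,x′)| ≤ (c₀^{(2.27)} + c₀^{(2.29)})(Lᵏε)⁻² e^{−(δ/2)r(Lᵏε)} e^{−(δ/2)|x − x′|}`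
for every `δ ≥ 0` with `(4d + 4a)δ ≤ γ₀`. [cite: Balaban1982Higgs2, (2.109) p.580] -/
theorem abs_hk_le_tower (t : TowerData P N) {a : ℝ} (ha : 0 < a) (hL : 1 < P.L) (h : TowerData.Reg a t) {δ : ℝ}
    (hδ0 : 0 ≤ δ) (hδ : (4 * P.d + 4 * a) * δ ≤ gam P.L a) (p q : ↥t.toInst.L6 × Ix N) :
    |t.toInst.hk a p q| ≤ (c227 P.L a δ + c229 P.d P.L a δ) * (P.mesh (t.j + 1))⁻¹ ^ 2 *
      Real.exp (-(δ / 2 * t.rad (t.j + 1))) * Real.exp (-(δ / 2 * (HiggsLattice.Site.tdist p.1.1 q.1.1 : ℝ))) :=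
  t.toInst.abs_hk_le ha hL (t.adm_toInst h) hδ0 hδ p q

/-- the printed radii `r(Lˡε) = R(1 + log(Lˡε)⁻¹)^r` of (2.7) at every level of a torus. [cite: Balaban1982Higgs2, (2.7) p.558] -/
def printedRad (Q : B2.Params) (P : HiggsLattice.Params) (l : ℕ) : ℝ := B2.rFn Q.R Q.r (P.mesh l)

/-- **(2.109), SECOND INEQUALITY, for the tower with the PRINTED radii** *"≤ O((Lᵏε)^κ)exp(−δ₀|x − x′|) … for … arbitrary κ"*: printed
ranges (`B2.Params.Printed`), `rad = r(L^·ε)`, `0 < Lᵏε ≤ 1`. [cite: Balaban1982Higgs2, (2.109) p.580, (2.7) p.558] -/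
theorem ineq2109_pow_tower (d L : ℕ) (hL : 1 < L) {a : ℝ} (ha : 0 < a) (Q : B2.Params) (hQ : Q.Printed) :
    ∃ δ₀ : ℝ, 0 < δ₀ ∧ ∀ ι : TowerIdx d L a, ι.P.mesh (ι.t.j + 1) ≤ 1 → ι.t.rad = printedRad Q ι.P →
      ∀ κ : ℝ, ∃ C' : ℝ, ∀ p q : ↥ι.t.toInst.L6 × Ix ι.N,
        |ι.t.toInst.hkUnit a p q| ≤ C' * ι.P.mesh (ι.t.j + 1) ^ κ *
          Real.exp (-(δ₀ * (HiggsLattice.Site.tdist p.1.1 q.1.1 : ℝ))) := by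
  obtain ⟨δ₀, hδ₀, h⟩ := ineq2109_pow_higgsLattice d L hL ha Q hQ
  refine ⟨δ₀, hδ₀, fun ι hs1 hrad κ => ?_⟩
  exact h ι.P ι.hd ι.hL ι.N ι.t.toInst (ι.t.adm_toInst ι.reg) (ι.P.mesh_pos _) hs1 (by simp [printedRad, hrad]) κ

section Norm

open scoped Matrix.Norms.L2Operator

/-- (3.8) ⇒ (3.12) p. 586 for the `H_k` of a tower step: `‖H_k‖_{L²} ≤ C(Lᵏε)⁻²·N·K_d(δ₀)·e^{−δ₁r(Lᵏε)}` with ONE `(C, δ₀, δ₁)` per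
`(d, L, a)`. [cite: Balaban1982Higgs2, (3.12) p.586] -/
theorem norm_Hk_le_tower (d L : ℕ) (hL : 1 < L) {a : ℝ} (ha : 0 < a) :
    ∃ C δ₀ δ₁ : ℝ, 0 < C ∧ 0 < δ₀ ∧ 0 < δ₁ ∧ ∀ ι : TowerIdx d L a,
      ‖ι.t.toInst.Hk a‖ ≤ C * (ι.P.mesh (ι.t.j + 1))⁻¹ ^ 2 *
        ((Module.finrank ℝ (E ι.N) : ℝ) * B4Sect5Proof.latticeConst ι.P.d δ₀) * Real.exp (-(δ₁ * ι.t.rad (ι.t.j + 1))) := by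
  obtain ⟨C, δ₀, δ₁, hC, hδ₀, hδ₁, h⟩ := norm_Hk_le d L hL ha
  exact ⟨C, δ₀, δ₁, hC, hδ₀, hδ₁, fun ι => h ι.P ι.hd ι.hL ι.N ι.t.toInst (ι.t.adm_toInst ι.reg)⟩

end Norm

/-! ## §4 The error term `O((Lᵏε)^κ)|Λ₃^{(k)}|` of (2.108) for the tower -/

/-- **The size of the `H_k`-form for a tower step** (bounded fields): `|⟨φ, H_kφ⟩| ≤ (c₀^{(2.27)}+c₀^{(2.29)})·N²·K_W·(Lᵏε)⁻⁴·t²·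
e^{−(δ/2)r(Lᵏε)}·|Λ₃^{(k)}|` for `|φ| ≤ t`, with `|Λ₃^{(k)}| = (towerRegion bad rad k 3).card`. [cite: Balaban1982Higgs2, (2.108) p.580] -/
theorem abs_form_hk_le_tower (t : TowerData P N) {a : ℝ} (ha : 0 < a) (hL : 1 < P.L) (h : TowerData.Reg a t) {δ : ℝ}
    (hδ0 : 0 < δ) (hδ : (4 * P.d + 4 * a) * δ ≤ gam P.L a) {s : ℝ} (φ : ↥t.toInst.L6 × Ix N → ℝ) (hφ : ∀ p, |φ p| ≤ s) :
    |φ ⬝ᵥ (t.toInst.Hk a *ᵥ φ)| ≤ (c227 P.L a δ + c229 P.d P.L a δ) * (Fintype.card (Ix N) : ℝ) ^ 2 * KW P.d δ *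
      (P.mesh (t.j + 1))⁻¹ ^ 2 * s ^ 2 * Real.exp (-(δ / 2 * t.rad (t.j + 1))) * ((t.lam 3).card : ℝ) :=
  abs_form_hk_le t.toInst ha hL (t.adm_toInst h) hδ0 hδ φ hφ

/-- **The printed `O((Lᵏε)^κ)|Λ₃^{(k)}|` for the tower**: with the printed radii and the (2.7)/(2.55)-type field bound
`|φ| ≤ c_l·(Lᵏε/L)^{−1/4}·p(Lᵏε/L)` on `Λ₆^{(k−1)′}`, for every `κ` ONE `C′` (per `d, L, a, N`, ranges, `c_l`) with
`(Lᵏε)²|⟨φ, H_kφ⟩| ≤ C′(Lᵏε)^κ|Λ₃^{(k)}|` (unit-lattice currency). [cite: Balaban1982Higgs2, (2.108) p.580, (2.55) p.570] -/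
theorem abs_form_hk_le_printed_tower (d L : ℕ) (hL : 1 < L) {a : ℝ} (ha : 0 < a) (N : ℕ) (Q : B2.Params) (hQ : Q.Printed)
    {cl : ℝ} (hcl : 0 ≤ cl) (κ : ℝ) :
    ∃ C' : ℝ, ∀ (P : HiggsLattice.Params), P.d = d → P.L = L → ∀ (t : TowerData P N), TowerData.Reg a t →
      P.mesh (t.j + 1) ≤ 1 → t.rad = printedRad Q P →
        ∀ (φ : ↥t.toInst.L6 × Ix N → ℝ),
          (∀ p, |φ p| ≤ cl * (P.mesh (t.j + 1) / Q.L) ^ (-(1 / 4 : ℝ)) * B2.pFn Q.b₀ Q.p (P.mesh (t.j + 1) / Q.L)) →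
          P.mesh (t.j + 1) ^ 2 * |φ ⬝ᵥ (t.toInst.Hk a *ᵥ φ)| ≤ C' * P.mesh (t.j + 1) ^ κ * ((t.lam 3).card : ℝ) := by
  obtain ⟨C', h⟩ := abs_form_hk_le_printed d L hL ha N Q hQ hcl κ
  refine ⟨C', fun P hd hL' t ht hs1 hrad φ hφ => ?_⟩
  exact h P hd hL' t.toInst (t.adm_toInst ht) (P.mesh_pos _) hs1 (by simp [printedRad, hrad]) φ hφ

/-! ## §5 The printed radii are admissible; non-vacuity with a field `≠ 0` -/

/-- `Lʲε ≤ L^{j+1}ε` (`L ≥ 1`). [cite: Balaban1982Higgs1, (1.19) p.607] -/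
theorem mesh_le_mesh_succ (P : HiggsLattice.Params) (l : ℕ) : P.mesh l ≤ P.mesh (l + 1) := by
  unfold HiggsLattice.Params.mesh
  have hL : (1 : ℝ) ≤ P.L := by exact_mod_cast P.hL
  have hε : 0 < P.ε := P.hε
  rw [pow_succ]
  nlinarith [pow_pos (lt_of_lt_of_le one_pos hL) l, mul_pos (pow_pos (lt_of_lt_of_le one_pos hL) l) hε]

/-- `r(s) = R(1 + log s⁻¹)^r ≥ 0` for `R ≥ 0` and `0 < s ≤ 1`. [cite: Balaban1982Higgs2, (2.7) p.558] -/
theorem rFn_nonneg_of_le_one {R r s : ℝ} (hR : 0 ≤ R) (hs : 0 < s) (hs1 : s ≤ 1) : 0 ≤ B2.rFn R r s := by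
  unfold B2.rFn
  have hlog : 0 ≤ Real.log s⁻¹ := Real.log_nonneg (one_le_inv_iff₀.mpr ⟨hs, hs1⟩)
  exact mul_nonneg hR (Real.rpow_nonneg (by linarith) r)

/-- the printed radii are nonnegative at every level `l` with `Lˡε ≤ 1` (printed ranges: `R > 0`). [cite: Balaban1982Higgs2, (2.7) p.558] -/
theorem printedRad_nonneg (Q : B2.Params) (hQ : Q.Printed) (P : HiggsLattice.Params) {l : ℕ} (hl : P.mesh l ≤ 1) :
    0 ≤ printedRad Q P l :=
  rFn_nonneg_of_le_one hQ.2.2.2.2.2.2.2.le (P.mesh_pos l) hl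

namespace TowerData

/-- **The tower step with the PRINTED radii `r(Lˡε)`** (level `k = j + 1 ≤ K` with `Lᵏε ≤ 1`). [cite: Balaban1982Higgs2, (2.7)–(2.8) p.558, (2.108) p.580] -/
def printed (Q : B2.Params) (hQ : Q.Printed) (j : ℕ) (hjK : j + 1 ≤ P.K) (hs1 : P.mesh (j + 1) ≤ 1) (C : ChargeData N)
    (A : HiggsLattice.VecField P 0) {msq : ℝ} (hmsq : 0 < msq) (dA : ℝ) (bad : (l : ℕ) → Set (HiggsLattice.Site P l)) :
    TowerData P N where
  j := j
  hjK := hjK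
  C := C
  A := A
  msq := msq
  hmsq := hmsq
  dA := dA
  bad := bad
  rad := printedRad Q P
  hrad0 := printedRad_nonneg Q hQ P ((mesh_le_mesh_succ P j).trans hs1)
  hrad1 := printedRad_nonneg Q hQ P hs1

/-- the printed instance has `rad = r(L^·ε)` (the hypothesis of `ineq2109_pow_tower`/`abs_form_hk_le_printed_tower`).
[cite: Balaban1982Higgs2, (2.7) p.558] -/
theorem printed_rad (Q : B2.Params) (hQ : Q.Printed) (j : ℕ) (hjK : j + 1 ≤ P.K) (hs1 : P.mesh (j + 1) ≤ 1) (C : ChargeData N)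
    (A : HiggsLattice.VecField P 0) {msq : ℝ} (hmsq : 0 < msq) (dA : ℝ) (bad : (l : ℕ) → Set (HiggsLattice.Site P l)) :
    (printed Q hQ j hjK hs1 C A hmsq dA bad).rad = printedRad Q P := rfl

/-- **A step with a CONSTANT field `B̃_μ ≡ v_μ`** (any `v`, in particular `v ≠ 0`): regularity modulus `δ_A = 0`; any torus with
`k = j + 1 ≤ K`, any charge, mass, large-field data and admissible radii. [cite: Balaban1982Higgs2, (2.108) p.580] -/
def const (j : ℕ) (hjK : j + 1 ≤ P.K) (C : ChargeData N) (v : Fin P.d → ℝ) {msq : ℝ} (hmsq : 0 < msq)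
    (bad : (l : ℕ) → Set (HiggsLattice.Site P l)) (rad : ℕ → ℝ) (hrad0 : 0 ≤ rad j) (hrad1 : 0 ≤ rad (j + 1)) :
    TowerData P N :=
  ⟨j, hjK, C, fun b => v b.dir, msq, hmsq, 0, bad, rad, hrad0, hrad1⟩

/-- the constant-field step is regular (for every family parameter `a`). [cite: Balaban1982Higgs2, (2.94)–(2.98) p.576] -/
theorem const_reg (a : ℝ) (j : ℕ) (hjK : j + 1 ≤ P.K) (C : ChargeData N) (v : Fin P.d → ℝ) {msq : ℝ} (hmsq : 0 < msq)
    (bad : (l : ℕ) → Set (HiggsLattice.Site P l)) (rad : ℕ → ℝ) (hrad0 : 0 ≤ rad j) (hrad1 : 0 ≤ rad (j + 1)) :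
    Reg a (const j hjK C v hmsq bad rad hrad0 hrad1) where
  reg := fun z _ μ ν => by simp [const]
  small := by simp [const]

end TowerData

/-- **Non-vacuity of the tower family with a field `≠ 0` allowed**: every torus of the model with the family's `d, L` and `K ≥ k`,
every `N`, charge, mass, large-field data, admissible radii and every constant field give an index. [cite: Balaban1982Higgs2, (2.109) p.580] -/
def constIdx {d L : ℕ} (a : ℝ) (P : HiggsLattice.Params) (hd : P.d = d) (hL : P.L = L) (N : ℕ) (j : ℕ) (hjK : j + 1 ≤ P.K)
    (C : ChargeData N) (v : Fin P.d → ℝ) {msq : ℝ} (hmsq : 0 < msq) (bad : (l : ℕ) → Set (HiggsLattice.Site P l))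
    (rad : ℕ → ℝ) (hrad0 : 0 ≤ rad j) (hrad1 : 0 ≤ rad (j + 1)) : TowerIdx d L a :=
  ⟨P, hd, hL, N, TowerData.const j hjK C v hmsq bad rad hrad0 hrad1, TowerData.const_reg a j hjK C v hmsq bad rad hrad0 hrad1⟩

/-- the field of `constIdx` is `≠ 0` as soon as `v ≠ 0` (the torus has a site). [cite: Balaban1982Higgs2, (2.109) p.580] -/
theorem constIdx_A_ne_zero {d L : ℕ} (a : ℝ) (P : HiggsLattice.Params) (hd : P.d = d) (hL : P.L = L) (N : ℕ) (j : ℕ)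
    (hjK : j + 1 ≤ P.K) (C : ChargeData N) {v : Fin P.d → ℝ} (hv : v ≠ 0) {msq : ℝ} (hmsq : 0 < msq)
    (bad : (l : ℕ) → Set (HiggsLattice.Site P l)) (rad : ℕ → ℝ) (hrad0 : 0 ≤ rad j) (hrad1 : 0 ≤ rad (j + 1))
    (x : HiggsLattice.Site P 0) :
    (constIdx a P hd hL N j hjK C v hmsq bad rad hrad0 hrad1).t.A ≠ 0 := by
  obtain ⟨μ, hμ⟩ := Function.ne_iff.mp hv
  intro h0
  have h1 := congrFun h0 ⟨x, μ⟩
  simp [constIdx, TowerData.const] at h1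
  exact hμ h1

end Literature.MathematicalPhysics.QuantumFieldTheory.Balaban1983to89.B2Ineq2109HiggsLatticeTower

end
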